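import Summits.Ventures.LatticeQCDFlow.Scoring.MadrasSokalRatioCLT
import Summits.Ventures.LatticeQCDFlow.Scoring.MadrasSokalDataWindow
import Summits.Ventures.LatticeQCDFlow.Scoring.MadrasSokalWindowSelector
import Summits.Ventures.LatticeQCDFlow.Scoring.LogRatioAgreementCLT

/-!
# The `τ_int` CLT AT SCORER B's DATA-CHOSEN WINDOW: `√N (τ̂_N(Ŵ_N) − τ_{Ŵ_N}) ⇒ N(0, ℓᵀΣℓ)` for block-factor data, `Ŵ_N = ms_window(ρ̂_N, c)`

HONEST FRAMING: exact (Metropolis-corrected) sampling algorithms for lattice gauge theory;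
figures of merit are autocorrelation/cost numbers at stated couplings and volumes; no
continuum-physics claim.

Venture `LatticeQCDFlow` (cell pub-lqcd), sub-topic `Scoring`; FANOUT row 16 (`su2-base`), GEN-8.
NEW WORK of the cell — the docking of GEN-7's fixed-window CLT
(`Scoring/MadrasSokalRatioCLT.tendstoInDistribution_tauIntWindow`) with GEN-8's
`Scoring/MadrasSokalDataWindow` (transfer at a strict crossing) and `Scoring/MadrasSokalWindowSelector`
(scorer B's `ms_window` typed, measurable); the per-window consistency it needs is proved here WITH
NO LIMIT OBJECT from GEN-8's scalar per-lag CLT (`LagProductCLT.tendstoInDistribution_acovHat_lag_gaussianReal`).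
No definition; nothing cited as a fact.

## Contents (`ξ` i.i.d., `X_i = F(ξ_i..ξ_{i+m})` with square-integrable lag products, `c(t) = E[X_0X_t]`, `c(0) ≠ 0`)

* §1 **`tendstoInMeasure_acovHat_blockFactor`** — `Γ̂_N(t) → c(t)` in probability, EVERY lag, no limit
  object (the scalar CLT pins the centring); `tendstoInMeasure_add_lim`, `tendstoInMeasure_div_lim`
  (sums / quotients of in-probability convergent sequences, from row 4's pairing + continuous mapping);
  **`tendstoInMeasure_tauIntWindow_blockFactor`** — `τ̂_N(W) → τ_W` in probability for EVERY window `W`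
  (induction on `W`), `τ̂_N(W) = tauIntWindow (Γ̂_N(·)/Γ̂_N(0)) W`, `τ_W = tauIntWindow (c(·)/c(0)) W`.
* §2 `measurable_tauIntWindow_acovHat` — the windowed estimates are measurable; hence
  `measurable_msWindowSel_acovHat` — scorer B's window `Ŵ_N = msWindowSel c Wmax (τ̂_N(·))` is a
  measurable function of the data.
* §3 **`tendstoInDistribution_tauIntWindow_at_msWindowSel`** — THE STATEMENT OF RECORD: if the
  population curve `W ↦ τ_W` has a STRICT Madras–Sokal window `w ≤ Wmax` at the scorer's `c > 0`, then
  `√N (τ̂_N(Ŵ_N) − τ_{Ŵ_N}) ⇒ ⟪∇τ(c_vec), Z⟫ = N(0, ℓᵀ Σ_{m+w} ℓ)` — the fixed-window law of GEN-7 at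
  `W = w`, read at the window the scorer actually chose from the same data (random centring included);
  `tendsto_measure_msWindowSel_acovHat_ne` — `P(Ŵ_N ≠ w) → 0`.

NOT CLAIMED: tangential crossings; `w > Wmax` (then the scorer returns the fallback `Wmax` and the
limit is the window-`Wmax` law iff … — not typed); the printed-bar coverage at `Ŵ_N` (one line from
`Scoring/MadrasSokalCoverage` + `tendsto_measure_at_msWindow` once that file is in the tree); numbers.
-/

noncomputable section

open MeasureTheory ProbabilityTheory Filter Finset WithLp
open scoped Topology ENNReal RealInnerProductSpace

namespace Summit.Ventures.LatticeQCDFlow.Scoring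

/-! ## §1 Consistency of every `Γ̂_N(t)` and every `τ̂_N(W)`, with no limit object -/

section Consistency

variable {Ω : Type*} [MeasurableSpace Ω] {P : Measure Ω} [IsProbabilityMeasure P]
variable {S : Type*} [MeasurableSpace S] {ξ : ℕ → Ω → S} {m : ℕ} {F : (Fin (m + 1) → S) → ℝ}

/-- **`Γ̂_N(t) → c(t)` in probability at every lag** (the scalar per-lag CLT pins the centring; no
limit object is needed since the law `N(0, Σ(t,t))` lives on `ℝ`). -/
theorem tendstoInMeasure_acovHat_blockFactor (hξ : ∀ i, Measurable (ξ i)) (hind : iIndepFun ξ P)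
    (hid : ∀ i, IdentDistrib (ξ i) (ξ 0) P P) (hF : Measurable F)
    (h4 : ∀ t, MemLp (fun ω => blockFactor F ξ 0 ω * blockFactor F ξ t ω) 2 P) (t : ℕ) :
    TendstoInMeasure P (fun N => acovHat (blockFactor F ξ) N t) atTop
      fun _ => P[fun ω => blockFactor F ξ 0 ω * blockFactor F ξ t ω] := by
  have h := tendstoInDistribution_acovHat_lag_gaussianReal hξ hind hid hF h4 (W := t) (Fin.last t)
  simp only [Fin.val_last] at h
  exact CardConsistency.tendstoInMeasure_of_tendstoInDistribution_scaled
    (a := fun n : ℕ => Real.sqrt (n : ℝ)) (Real.tendsto_sqrt_atTop.comp tendsto_natCast_atTop_atTop) h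

omit [IsProbabilityMeasure P] in
/-- Sums of in-probability convergent real sequences converge in probability to the sum. -/
theorem tendstoInMeasure_add_lim {U V : ℕ → Ω → ℝ} {u v : ℝ}
    (hU : TendstoInMeasure P U atTop fun _ => u) (hV : TendstoInMeasure P V atTop fun _ => v) :
    TendstoInMeasure P (fun N ω => U N ω + V N ω) atTop fun _ => u + v :=
  CardConsistency.tendstoInMeasure_comp_continuousAt_normed (CardConsistency.tendstoInMeasure_prodMk hU hV)
    (φ := fun q : ℝ × ℝ => q.1 + q.2) (by fun_prop : Continuous fun q : ℝ × ℝ => q.1 + q.2).continuousAt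

omit [IsProbabilityMeasure P] in
/-- Quotients of in-probability convergent real sequences converge in probability to the quotient
(denominator limit `≠ 0`). -/
theorem tendstoInMeasure_div_lim {U V : ℕ → Ω → ℝ} {u v : ℝ} (hv : v ≠ 0)
    (hU : TendstoInMeasure P U atTop fun _ => u) (hV : TendstoInMeasure P V atTop fun _ => v) :
    TendstoInMeasure P (fun N ω => U N ω / V N ω) atTop fun _ => u / v :=
  CardConsistency.tendstoInMeasure_comp_continuousAt_normed (CardConsistency.tendstoInMeasure_prodMk hU hV)
    (φ := fun q : ℝ × ℝ => q.1 / q.2) (continuousAt_fst.div continuousAt_snd hv)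

/-- A constant sequence converges in measure to its value. -/
theorem tendstoInMeasure_const_real (u : ℝ) :
    TendstoInMeasure P (fun (_ : ℕ) (_ : Ω) => u) atTop fun _ => u :=
  tendstoInMeasure_of_tendsto_ae (fun _ => aestronglyMeasurable_const)
    (Eventually.of_forall fun _ => tendsto_const_nhds)

/-- **`τ̂_N(W) → τ_W` in probability at EVERY window `W`** (`c(0) ≠ 0`): induction on `W` over
`tauIntWindow ρ (W+1) = tauIntWindow ρ W + ρ(W+1)`, each `ρ̂_N(t) = Γ̂_N(t)/Γ̂_N(0) → c(t)/c(0)`. -/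
theorem tendstoInMeasure_tauIntWindow_blockFactor (hξ : ∀ i, Measurable (ξ i)) (hind : iIndepFun ξ P)
    (hid : ∀ i, IdentDistrib (ξ i) (ξ 0) P P) (hF : Measurable F)
    (h4 : ∀ t, MemLp (fun ω => blockFactor F ξ 0 ω * blockFactor F ξ t ω) 2 P)
    (hσ : P[fun ω => blockFactor F ξ 0 ω * blockFactor F ξ 0 ω] ≠ 0) (W : ℕ) :
    TendstoInMeasure P (fun (N : ℕ) ω => tauIntWindow (fun t => acovHat (blockFactor F ξ) N t ω
        / acovHat (blockFactor F ξ) N 0 ω) W) atTop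
      fun _ => tauIntWindow (fun t => P[fun ω => blockFactor F ξ 0 ω * blockFactor F ξ t ω]
        / P[fun ω => blockFactor F ξ 0 ω * blockFactor F ξ 0 ω]) W := by
  induction W with
  | zero => simpa only [tauIntWindow, sum_range_zero, add_zero] using tendstoInMeasure_const_real (P := P) (1 / 2 : ℝ)
  | succ W ih =>
    have hρ := tendstoInMeasure_div_lim hσ (tendstoInMeasure_acovHat_blockFactor hξ hind hid hF h4 (W + 1))
      (tendstoInMeasure_acovHat_blockFactor hξ hind hid hF h4 0)
    have h := tendstoInMeasure_add_lim ih hρ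
    simpa only [tauIntWindow, sum_range_succ, add_assoc] using h

end Consistency

/-! ## §2 Measurability of the windowed estimates and of the chosen window -/

section Measurability

variable {Ω : Type*} [MeasurableSpace Ω] {P : Measure Ω}
variable {S : Type*} [MeasurableSpace S] {ξ : ℕ → Ω → S} {m : ℕ} {F : (Fin (m + 1) → S) → ℝ}

/-- The windowed estimates `τ̂_N(W) = tauIntWindow (Γ̂_N(·)/Γ̂_N(0)) W` are measurable. -/
theorem measurable_tauIntWindow_acovHat (hξ : ∀ i, Measurable (ξ i)) (hF : Measurable F) (N W : ℕ) :
    Measurable fun ω => tauIntWindow (fun t => acovHat (blockFactor F ξ) N t ω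
      / acovHat (blockFactor F ξ) N 0 ω) W := by
  simp only [tauIntWindow]
  exact measurable_const.add (Finset.measurable_sum _ fun t _ =>
    (measurable_acovHat_blockFactor hξ hF N _).div (measurable_acovHat_blockFactor hξ hF N 0))

/-- **Scorer B's data-chosen window is a measurable function of the data.** -/
theorem measurable_msWindowSel_acovHat (hξ : ∀ i, Measurable (ξ i)) (hF : Measurable F) (c : ℝ)
    (Wmax N : ℕ) :
    Measurable fun ω => msWindowSel c Wmax (fun W => tauIntWindow (fun t => acovHat (blockFactor F ξ) N t ω
      / acovHat (blockFactor F ξ) N 0 ω) W) :=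
  measurable_msWindowSel (fun W => measurable_tauIntWindow_acovHat hξ hF N W) c Wmax

end Measurability

/-! ## §3 The CLT at the data-chosen window -/

section AtWindow

variable {Ω : Type*} [MeasurableSpace Ω] {P : Measure Ω} [IsProbabilityMeasure P]
variable {Ω' : Type*} [MeasurableSpace Ω'] {P' : Measure Ω'} [IsProbabilityMeasure P']
variable {S : Type*} [MeasurableSpace S] {ξ : ℕ → Ω → S} {m : ℕ} {F : (Fin (m + 1) → S) → ℝ}

/-- **`P(Ŵ_N ≠ w) → 0`**: scorer B's window of the empirical curve equals the strict population
Madras–Sokal window `w ≤ Wmax` with probability `→ 1`. -/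
theorem tendsto_measure_msWindowSel_acovHat_ne (hξ : ∀ i, Measurable (ξ i)) (hind : iIndepFun ξ P)
    (hid : ∀ i, IdentDistrib (ξ i) (ξ 0) P P) (hF : Measurable F)
    (h4 : ∀ t, MemLp (fun ω => blockFactor F ξ 0 ω * blockFactor F ξ t ω) 2 P)
    (hσ : P[fun ω => blockFactor F ξ 0 ω * blockFactor F ξ 0 ω] ≠ 0) {c : ℝ} (hc : 0 < c)
    {w Wmax : ℕ} (hwle : w ≤ Wmax)
    (hw : IsStrictMSWindow c (fun W => tauIntWindow (fun t =>
      P[fun ω => blockFactor F ξ 0 ω * blockFactor F ξ t ω]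
        / P[fun ω => blockFactor F ξ 0 ω * blockFactor F ξ 0 ω]) W) w) :
    Tendsto (fun N : ℕ => P {ω | msWindowSel c Wmax (fun W => tauIntWindow (fun t =>
        acovHat (blockFactor F ξ) N t ω / acovHat (blockFactor F ξ) N 0 ω) W) ≠ w}) atTop (𝓝 0) := by
  -- name the curves to keep unification first-order
  set τhat : ℕ → ℕ → Ω → ℝ := fun N W ω => tauIntWindow (fun t => acovHat (blockFactor F ξ) N t ω
      / acovHat (blockFactor F ξ) N 0 ω) W with hτhat
  set τW : ℕ → ℝ := fun W => tauIntWindow (fun t => P[fun ω => blockFactor F ξ 0 ω * blockFactor F ξ t ω]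
      / P[fun ω => blockFactor F ξ 0 ω * blockFactor F ξ 0 ω]) W with hτW
  have hconv : ∀ W, 1 ≤ W → W ≤ w → TendstoInMeasure P (fun N => τhat N W) atTop fun _ => τW W :=
    fun W _ _ => tendstoInMeasure_tauIntWindow_blockFactor hξ hind hid hF h4 hσ W
  have hsel : ∀ N ω, IsMSWindow c (fun W => τhat N W ω) w →
      msWindowSel c Wmax (fun W => τhat N W ω) = w :=
    fun _ _ h => msWindowSel_eq_of_isMSWindow h hwle
  exact tendsto_measure_msWindowSel_ne hc hw hconv hsel

/-- **THE `τ_int` CLT AT SCORER B's DATA-CHOSEN WINDOW.**  `ξ` i.i.d., `X_i = F(ξ_i, …, ξ_{i+m})` with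
square-integrable lag products, `c(0) = E X_0² ≠ 0`; the population curve
`W ↦ τ_W = tauIntWindow (c(·)/c(0)) W` has a STRICT Madras–Sokal window `w` at the scorer's constant
`c > 0`, within the scanned range `w ≤ Wmax`; `Z` the Gaussian limit vector of the joint CLT at window
`w` (`⟪a, Z⟫ ~ N(0, aᵀ Σ_{m+w} a)`).  Then for `Ŵ_N(ω) = msWindowSel c Wmax (τ̂_N(·)(ω))` — the window
scorer B computes from the same data — `√N (τ̂_N(Ŵ_N) − τ_{Ŵ_N}) ⇒ ⟪∇τ(c_vec), Z⟫`, the fixed-window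
limit `N(0, ℓᵀ Σ ℓ)` of `MadrasSokalRatioCLT` at `W = w`. -/
theorem tendstoInDistribution_tauIntWindow_at_msWindowSel (hξ : ∀ i, Measurable (ξ i))
    (hind : iIndepFun ξ P) (hid : ∀ i, IdentDistrib (ξ i) (ξ 0) P P) (hF : Measurable F)
    (h4 : ∀ t, MemLp (fun ω => blockFactor F ξ 0 ω * blockFactor F ξ t ω) 2 P)
    (hσ : P[fun ω => blockFactor F ξ 0 ω * blockFactor F ξ 0 ω] ≠ 0) {c : ℝ} (hc : 0 < c)
    {w Wmax : ℕ} (hwle : w ≤ Wmax)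
    (hw : IsStrictMSWindow c (fun W => tauIntWindow (fun t =>
      P[fun ω => blockFactor F ξ 0 ω * blockFactor F ξ t ω]
        / P[fun ω => blockFactor F ξ 0 ω * blockFactor F ξ 0 ω]) W) w)
    {Z : Ω' → EuclideanSpace ℝ (Fin (w + 1))} (hZm : AEMeasurable Z P')
    (hZ : ∀ a : EuclideanSpace ℝ (Fin (w + 1)), HasLaw (fun ω' => ⟪a, Z ω'⟫) (gaussianReal 0
      (∑ s : Fin (w + 1), ∑ t : Fin (w + 1),
        a s * a t * lagProdACov (blockFactor F ξ) P (m + w) s t).toNNReal) P') :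
    TendstoInDistribution
      (fun (N : ℕ) ω =>
        Real.sqrt N * (tauIntWindow (fun t => acovHat (blockFactor F ξ) N t ω
            / acovHat (blockFactor F ξ) N 0 ω)
            (msWindowSel c Wmax (fun W => tauIntWindow (fun t =>
              acovHat (blockFactor F ξ) N t ω / acovHat (blockFactor F ξ) N 0 ω) W))
          - tauIntWindow (fun t => P[fun ω => blockFactor F ξ 0 ω * blockFactor F ξ t ω]
              / P[fun ω => blockFactor F ξ 0 ω * blockFactor F ξ 0 ω])
            (msWindowSel c Wmax (fun W => tauIntWindow (fun t =>
              acovHat (blockFactor F ξ) N t ω / acovHat (blockFactor F ξ) N 0 ω) W))))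
      atTop (fun ω' => ⟪tauHatGrad w (toLp 2 fun t : Fin (w + 1) =>
        P[fun ω => blockFactor F ξ 0 ω * blockFactor F ξ t ω]), Z ω'⟫) (fun _ => P) P' := by
  set τhat : ℕ → ℕ → Ω → ℝ := fun N W ω => tauIntWindow (fun t => acovHat (blockFactor F ξ) N t ω
      / acovHat (blockFactor F ξ) N 0 ω) W with hτhat
  set τW : ℕ → ℝ := fun W => tauIntWindow (fun t => P[fun ω => blockFactor F ξ 0 ω * blockFactor F ξ t ω]
      / P[fun ω => blockFactor F ξ 0 ω * blockFactor F ξ 0 ω]) W with hτW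
  have hclt : TendstoInDistribution (fun (N : ℕ) ω => Real.sqrt N * (τhat N w ω - τW w)) atTop
      (fun ω' => ⟪tauHatGrad w (toLp 2 fun t : Fin (w + 1) =>
        P[fun ω => blockFactor F ξ 0 ω * blockFactor F ξ t ω]), Z ω'⟫) (fun _ => P) P' :=
    tendstoInDistribution_tauIntWindow hξ hind hid hF h4 w hσ hZm hZ
  have hτm : ∀ N W, Measurable (τhat N W) := fun N W => measurable_tauIntWindow_acovHat hξ hF N W
  have hWm : ∀ N, Measurable fun ω => msWindowSel c Wmax (fun W => τhat N W ω) :=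
    fun N => measurable_msWindowSel (fun W => hτm N W) c Wmax
  have hconv : ∀ W, 1 ≤ W → W ≤ w → TendstoInMeasure P (fun N => τhat N W) atTop fun _ => τW W :=
    fun W _ _ => tendstoInMeasure_tauIntWindow_blockFactor hξ hind hid hF h4 hσ W
  have hsel : ∀ N ω, IsMSWindow c (fun W => τhat N W ω) w →
      msWindowSel c Wmax (fun W => τhat N W ω) = w :=
    fun _ _ h => msWindowSel_eq_of_isMSWindow h hwle
  exact tendstoInDistribution_tauHat_at_msWindow hclt hτm hWm hc hw hconv hsel

end AtWindow

end Summit.Ventures.LatticeQCDFlow.Scoring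

end

noncomputable section

open MeasureTheory ProbabilityTheory Filter Finset WithLp
open scoped Topology ENNReal RealInnerProductSpace

namespace Summit.Ventures.LatticeQCDFlow.Scoring

/-! ## §4 (GEN-8, appended) Consistency AT the data-chosen window: the scorer's printed `τ̂_N(Ŵ_N) → τ_w` and `Ŵ_N → w` in probability

§3 transfers the LIMIT LAW through the data-chosen window.  The plainer statement a reader of the
leaderboard relies on first — the printed number itself converges to the windowed truth at the
population window — is recorded here, together with the convergence of the printed WINDOW. -/

section AtWindowConsistency

variable {Ω : Type*} [MeasurableSpace Ω] {P : Measure Ω}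

/-- **Transfer of convergence in measure through a data-chosen index** (abstract): if
`T_N(w) → θ` in measure and `P(Ŵ_N ≠ w) → 0` then `T_N(Ŵ_N) → θ` in measure. -/
theorem tendstoInMeasure_dataIndex {T : ℕ → ℕ → Ω → ℝ} {Wsel : ℕ → Ω → ℕ} {w : ℕ} {θ : ℝ}
    (hT : TendstoInMeasure P (fun N => T N w) atTop fun _ => θ)
    (hW : Tendsto (fun N => P {ω | Wsel N ω ≠ w}) atTop (𝓝 0)) :
    TendstoInMeasure P (fun N ω => T N (Wsel N ω) ω) atTop fun _ => θ := by
  intro ε hε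
  have hsub : ∀ N, {ω | ε ≤ edist (T N (Wsel N ω) ω) θ}
      ⊆ {ω | ε ≤ edist (T N w ω) θ} ∪ {ω | Wsel N ω ≠ w} := by
    intro N ω hω
    by_cases h : Wsel N ω = w
    · left; simp only [Set.mem_setOf_eq] at hω ⊢; rwa [h] at hω
    · exact Or.inr h
  have h0 : Tendsto (fun N => P {ω | ε ≤ edist (T N w ω) θ} + P {ω | Wsel N ω ≠ w}) atTop (𝓝 0) := by
    simpa using (hT ε hε).add hW
  exact tendsto_of_tendsto_of_tendsto_of_le_of_le tendsto_const_nhds h0 (fun _ => bot_le)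
    fun N => (measure_mono (hsub N)).trans (measure_union_le _ _)

/-- **The data-chosen window converges in measure** (as a real sequence): `P(Ŵ_N ≠ w) → 0` ⇒
`(Ŵ_N : ℝ) → w` in measure. -/
theorem tendstoInMeasure_natCast_of_measure_ne_tendsto_zero {Wsel : ℕ → Ω → ℕ} {w : ℕ}
    (hW : Tendsto (fun N => P {ω | Wsel N ω ≠ w}) atTop (𝓝 0)) :
    TendstoInMeasure P (fun N ω => (Wsel N ω : ℝ)) atTop fun _ => (w : ℝ) := by
  intro ε hε
  refine tendsto_of_tendsto_of_tendsto_of_le_of_le tendsto_const_nhds hW (fun _ => bot_le)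
    fun N => measure_mono fun ω hω => ?_
  simp only [Set.mem_setOf_eq] at hω ⊢
  intro h
  rw [h, edist_self] at hω
  exact absurd hω (not_le.2 hε)

variable [IsProbabilityMeasure P]
variable {S : Type*} [MeasurableSpace S] {ξ : ℕ → Ω → S} {m : ℕ} {F : (Fin (m + 1) → S) → ℝ}

/-- **THE SCORER'S PRINTED `τ̂` AT ITS OWN WINDOW IS CONSISTENT.**  Block-factor data with
square-integrable lag products, `c(0) ≠ 0`, a strict population Madras–Sokal window `w ≤ Wmax` at
`c > 0`.  Then `τ̂_N(Ŵ_N) → τ_w` in probability, `Ŵ_N = msWindowSel c Wmax (τ̂_N(·))`. -/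
theorem tendstoInMeasure_tauIntWindow_at_msWindowSel (hξ : ∀ i, Measurable (ξ i))
    (hind : iIndepFun ξ P) (hid : ∀ i, IdentDistrib (ξ i) (ξ 0) P P) (hF : Measurable F)
    (h4 : ∀ t, MemLp (fun ω => blockFactor F ξ 0 ω * blockFactor F ξ t ω) 2 P)
    (hσ : P[fun ω => blockFactor F ξ 0 ω * blockFactor F ξ 0 ω] ≠ 0) {c : ℝ} (hc : 0 < c)
    {w Wmax : ℕ} (hwle : w ≤ Wmax)
    (hw : IsStrictMSWindow c (fun W => tauIntWindow (fun t =>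
      P[fun ω => blockFactor F ξ 0 ω * blockFactor F ξ t ω]
        / P[fun ω => blockFactor F ξ 0 ω * blockFactor F ξ 0 ω]) W) w) :
    TendstoInMeasure P (fun (N : ℕ) ω => tauIntWindow (fun t => acovHat (blockFactor F ξ) N t ω
        / acovHat (blockFactor F ξ) N 0 ω)
        (msWindowSel c Wmax (fun W => tauIntWindow (fun t =>
          acovHat (blockFactor F ξ) N t ω / acovHat (blockFactor F ξ) N 0 ω) W))) atTop
      fun _ => tauIntWindow (fun t => P[fun ω => blockFactor F ξ 0 ω * blockFactor F ξ t ω]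
        / P[fun ω => blockFactor F ξ 0 ω * blockFactor F ξ 0 ω]) w :=
  tendstoInMeasure_dataIndex (T := fun N W ω => tauIntWindow (fun t => acovHat (blockFactor F ξ) N t ω
      / acovHat (blockFactor F ξ) N 0 ω) W)
    (tendstoInMeasure_tauIntWindow_blockFactor hξ hind hid hF h4 hσ w)
    (tendsto_measure_msWindowSel_acovHat_ne hξ hind hid hF h4 hσ hc hwle hw)

/-- **… and the printed WINDOW converges**: `(Ŵ_N : ℝ) → w` in probability. -/
theorem tendstoInMeasure_msWindowSel_acovHat (hξ : ∀ i, Measurable (ξ i))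
    (hind : iIndepFun ξ P) (hid : ∀ i, IdentDistrib (ξ i) (ξ 0) P P) (hF : Measurable F)
    (h4 : ∀ t, MemLp (fun ω => blockFactor F ξ 0 ω * blockFactor F ξ t ω) 2 P)
    (hσ : P[fun ω => blockFactor F ξ 0 ω * blockFactor F ξ 0 ω] ≠ 0) {c : ℝ} (hc : 0 < c)
    {w Wmax : ℕ} (hwle : w ≤ Wmax)
    (hw : IsStrictMSWindow c (fun W => tauIntWindow (fun t =>
      P[fun ω => blockFactor F ξ 0 ω * blockFactor F ξ t ω]
        / P[fun ω => blockFactor F ξ 0 ω * blockFactor F ξ 0 ω]) W) w) :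
    TendstoInMeasure P (fun (N : ℕ) ω => ((msWindowSel c Wmax (fun W => tauIntWindow (fun t =>
        acovHat (blockFactor F ξ) N t ω / acovHat (blockFactor F ξ) N 0 ω) W) : ℕ) : ℝ)) atTop
      fun _ => (w : ℝ) :=
  tendstoInMeasure_natCast_of_measure_ne_tendsto_zero
    (tendsto_measure_msWindowSel_acovHat_ne hξ hind hid hF h4 hσ hc hwle hw)

end AtWindowConsistency

end Summit.Ventures.LatticeQCDFlow.Scoring

end
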